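import Literature.Probability.RandomPlanarGeometry.SLETransienceKappaFourEight
import Literature.Probability.RandomPlanarGeometry.SLETransienceKappaLtFour
import Literature.Probability.RandomPlanarGeometry.SLETransience
import HarnessLib

/-!
# Transience of the SLE trace (Rohde–Schramm (2005), Thm. 7.1): assembly

Trunk T-STOCH. The named fact `Literature.Probability.RandomPlanarGeometry.tendsto_norm_sleTrace_atTop`
(Rohde–Schramm (2005), Thm. 7.1 with the Update for `κ = 8`: for every `κ > 0`, a.s.
`|γ(t)| → ∞`) assembled from what this library proves and from precisely delimited printed
results:

* **proved** from Rohde–Schramm's derivative estimate Cor. 3.5 (`RohdeSchramm2005_cor35`, through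
  which SLE_κ, `κ ≠ 8`, is a.s. generated by a curve): the phases `0 < κ < 4`
  (`tendsto_norm_sleTrace_atTop_of_cor35_of_lt_four`, Koebe route to Lemma 7.2) and `4 < κ < 8`
  (`tendsto_norm_sleTrace_atTop_of_cor35_of_four_lt_of_lt_eight`, Lemma 7.3 with the Markov
  property at a fixed rational time); packaged as `tendsto_norm_sleTrace_atTop_of_cor35_of_lt_eight`;
* **used as hypotheses**, restricted to exactly the values where they are still needed: the
  simple-path step of the proof of Thm. 7.1 (p. 911) at `κ = 4` only (two prime ends at the base of
  the simple slit, the Markov property and Lemma 7.2 at `κ = 4` with its dilogarithm local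
  martingale; the case `κ = 4` of `RohdeSchramm2005_thm71_simpleStep`), the conclusion of Lemma 7.3
  for `κ > 8` only (Thm. 6.4, Lemma 6.5, Fubini and Cor. 5.3; from `RohdeSchramm2005_lem73`), and
  for `κ = 8` the Update (`RohdeSchramm2005_thm71_eight`) applied to Lawler–Schramm–Werner's
  `hasSLETrace_eight`.

The assembly is `tendsto_norm_sleTrace_atTop_of_cor35_of_facts` (restricted hypotheses) and
`tendsto_norm_sleTrace_atTop_of_cor35_of_RS05` (fed from the named facts of `SLETransience`).

## References

* S. Rohde, O. Schramm, *Basic properties of SLE*, Ann. of Math. 161 (2005), Thm. 7.1,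
  Lemmas 7.2, 7.3, Update (p. 911).
* G. F. Lawler, O. Schramm, W. Werner, *Conformal invariance of planar loop-erased random walks
  and uniform spanning trees*, Ann. Probab. 32 (2004), Thm. 4.7.
-/

noncomputable section

open Set Filter Topology MeasureTheory
open UpperHalfPlane (upperHalfPlaneSet)
open scoped NNReal

namespace Literature.Probability.RandomPlanarGeometry

/-! ### The proved phases -/

variable {κ : ℝ≥0}

/-- **Transience of the SLE_κ trace for `0 < κ < 8`, `κ ≠ 4`, from Rohde–Schramm's Cor. 3.5**
(`tendsto_norm_sleTrace_atTop_of_cor35_of_lt_four` and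
`tendsto_norm_sleTrace_atTop_of_cor35_of_four_lt_of_lt_eight`).
[cite: RohdeSchramm2005, Thm 7.1] -/
theorem tendsto_norm_sleTrace_atTop_of_cor35_of_lt_eight
    (h : RohdeSchramm2005_cor35 Process.preWienerMeasure) (hκ0 : 0 < κ) (hκ4 : κ ≠ 4) (hκ8 : κ < 8) :
    ∀ᵐ ω ∂Process.preWienerMeasure, Tendsto (fun t ↦ ‖sleTrace κ ω t‖) atTop atTop := by
  rcases hκ4.lt_or_gt with hlt | hgt
  · exact tendsto_norm_sleTrace_atTop_of_cor35_of_lt_four h hκ0 hlt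
  · exact tendsto_norm_sleTrace_atTop_of_cor35_of_four_lt_of_lt_eight h hgt hκ8

/-- **Transience for `κ > 8` from Cor. 3.5 and the conclusion of Lemma 7.3 at `t = 1`**
(hypothesis `h9`: for `κ > 8`, a.s. `K₁ ⊇ {z ∈ ℍ : |z| < ε}` for some `ε > 0` — the `κ > 8` branch
of `RohdeSchramm2005_lem73`, whose printed proof uses Thm. 6.4, Lemma 6.5, the Markov property at
`τ(z₀)`, Fubini and Cor. 5.3): a sealed half-disc at a fixed time with positive probability gives
a.s. transience (`tendsto_norm_sleTrace_atTop_of_measure_halfDisc_ne_zero_at`).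
[cite: RohdeSchramm2005, Thm 7.1] -/
theorem tendsto_norm_sleTrace_atTop_of_cor35_of_halfDisc_gt_eight
    (h : RohdeSchramm2005_cor35 Process.preWienerMeasure)
    (h9 : ∀ {κ : ℝ≥0}, 8 < κ → ∀ᵐ ω ∂Process.preWienerMeasure,
      ∃ ε : ℝ, 0 < ε ∧ {z ∈ upperHalfPlaneSet | ‖z‖ < ε} ⊆ sleHull κ ω 1)
    (hκ : 8 < κ) :
    ∀ᵐ ω ∂Process.preWienerMeasure, Tendsto (fun t ↦ ‖sleTrace κ ω t‖) atTop atTop := by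
  have h0 : HasSLETrace κ := hasSLETrace_of_ne_eight_of_cor35 h (ne_of_gt hκ)
  refine tendsto_norm_sleTrace_atTop_of_measure_halfDisc_ne_zero_at h0 1 ?_
  haveI := isProbabilityMeasure_preWienerMeasure'
  intro hzero
  have hae := h9 hκ
  have : Process.preWienerMeasure univ = 0 :=
    measure_mono_null_ae (by filter_upwards [hae] with ω hω _ using hω) hzero
  exact one_ne_zero (measure_univ.symm.trans this)

/-- **Transience at `κ = 4` from Cor. 3.5 and the simple-path step at `κ = 4`** (hypothesis
`h4`: if SLE₄ is generated by a curve then a.s. `0 ∉ cl γ[1, ∞)` — the case `κ = 4` of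
`RohdeSchramm2005_thm71_simpleStep`, Rohde–Schramm's p. 911 argument with the two prime ends of
`H₁` at `0`, the Markov property and Lemma 7.2 at `κ = 4`; for `κ < 4` this is proved,
`ae_zero_notMem_closure_sleTrace_image_Ici_of_lt_four`). [cite: RohdeSchramm2005, Thm 7.1] -/
theorem tendsto_norm_sleTrace_atTop_of_cor35_of_simpleStep_four
    (h : RohdeSchramm2005_cor35 Process.preWienerMeasure)
    (h4 : HasSLETrace 4 →
      ∀ᵐ ω ∂Process.preWienerMeasure, (0 : ℂ) ∉ closure (sleTrace 4 ω '' Ici 1)) :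
    ∀ᵐ ω ∂Process.preWienerMeasure, Tendsto (fun t ↦ ‖sleTrace 4 ω t‖) atTop atTop := by
  have h0 : HasSLETrace 4 := hasSLETrace_of_ne_eight_of_cor35 h (by norm_num)
  refine tendsto_norm_sleTrace_atTop_of_measure_ne_zero_at h0 1 ?_
  haveI := isProbabilityMeasure_preWienerMeasure'
  intro hzero
  have : Process.preWienerMeasure univ = 0 :=
    measure_mono_null_ae (by filter_upwards [h4 h0] with ω hω _ using hω) hzero
  exact one_ne_zero (measure_univ.symm.trans this)

/-! ### The assembly -/

/-- **`tendsto_norm_sleTrace_atTop` (Rohde–Schramm (2005), Thm. 7.1 with the Update) from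
Cor. 3.5 and the remaining printed inputs, each restricted to exactly where it is still needed.**
For `κ ∈ (0, 4) ∪ (4, 8)` transience is proved from Cor. 3.5 alone
(`tendsto_norm_sleTrace_atTop_of_cor35_of_lt_eight`); at `κ = 4` the simple-path step of p. 911
(`h4`, the case `κ = 4` of `RohdeSchramm2005_thm71_simpleStep`), for `κ > 8` the conclusion of
Lemma 7.3 at `t = 1` (`h9`, from `RohdeSchramm2005_lem73`), and at `κ = 8` the Update
(`RohdeSchramm2005_thm71_eight`) applied to Lawler–Schramm–Werner's extension of Thm. 5.1
(`hasSLETrace_eight`) are used. [cite: RohdeSchramm2005, Thm 7.1 and Update (p. 911)] -/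
theorem tendsto_norm_sleTrace_atTop_of_cor35_of_facts
    (h35 : RohdeSchramm2005_cor35 Process.preWienerMeasure)
    (h4 : HasSLETrace 4 →
      ∀ᵐ ω ∂Process.preWienerMeasure, (0 : ℂ) ∉ closure (sleTrace 4 ω '' Ici 1))
    (h9 : ∀ {κ : ℝ≥0}, 8 < κ → ∀ᵐ ω ∂Process.preWienerMeasure,
      ∃ ε : ℝ, 0 < ε ∧ {z ∈ upperHalfPlaneSet | ‖z‖ < ε} ⊆ sleHull κ ω 1)
    (h8e : hasSLETrace_eight) (h8 : RohdeSchramm2005_thm71_eight) :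
    tendsto_norm_sleTrace_atTop := by
  intro κ hκ0
  rcases lt_trichotomy κ 8 with hlt | rfl | hgt
  · rcases eq_or_ne κ 4 with rfl | hκ4
    · exact tendsto_norm_sleTrace_atTop_of_cor35_of_simpleStep_four h35 h4
    · exact tendsto_norm_sleTrace_atTop_of_cor35_of_lt_eight h35 hκ0 hκ4 hlt
  · exact h8 h8e
  · exact tendsto_norm_sleTrace_atTop_of_cor35_of_halfDisc_gt_eight h35 h9 hgt

/-- **The target fact from Cor. 3.5 and the named facts of `SLETransience`**: compared with
`tendsto_norm_sleTrace_atTop_of_RS05` (which cites Thm. 5.1 as `hasSLETrace_of_ne_eight` and uses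
`RohdeSchramm2005_thm71_simpleStep` on all of `κ ≤ 4` and `RohdeSchramm2005_lem73` on all of
`κ > 4`), the simple-path step is now used only at `κ = 4` and Lemma 7.3 only for `κ > 8`.
[cite: RohdeSchramm2005, Thm 7.1 and Update (p. 911)] -/
theorem tendsto_norm_sleTrace_atTop_of_cor35_of_RS05
    (h35 : RohdeSchramm2005_cor35 Process.preWienerMeasure)
    (hle : RohdeSchramm2005_thm71_simpleStep) (h73 : RohdeSchramm2005_lem73)
    (h8e : hasSLETrace_eight) (h8 : RohdeSchramm2005_thm71_eight) :
    tendsto_norm_sleTrace_atTop :=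
  tendsto_norm_sleTrace_atTop_of_cor35_of_facts h35 (fun hκ ↦ hle le_rfl hκ)
    (fun h9 ↦ h73 (lt_trans (by norm_num) h9) (ne_of_gt h9) one_pos) h8e h8

end Literature.Probability.RandomPlanarGeometry
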